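import Summits.NavierStokesRegularity.NavierStokesRegularity.Theorems.SqueezeCycleExtremalBiaxialitySubcriticalProductionLever
import Summits.NavierStokesRegularity.NavierStokesRegularity.Theorems.SqueezeCycleExtremalBiaxialitySubcriticalOfLiouville
import Summits.NavierStokesRegularity.NavierStokesRegularity.Theorems.SqueezeCycleMustSqueezeSimDictionary
import Summits.NavierStokesRegularity.NavierStokesRegularity.Theorems.SqueezeCycleMustSqueezeGradEnergyAverage
import Summits.NavierStokesRegularity.NavierStokesRegularity.Theorems.SqueezeCycleMustSqueezeTwoPassGronwall
import Literature.Analysis.FluidPDE.LerayGaugeStrainSpectrum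
import Mathlib.Analysis.SpecialFunctions.SmoothTransition
import HarnessLib

/-!
# Route `SqueezeCycle`, crux `ExtremalBiaxialitySubcritical` — the leaky quarter law in production-ceiling currency (line `quarter-bootstrap-pinning`, stub `stub_leakyQuarterLawCeiling`)

Helper file for item `stmt-NavierStokesRegularity-11609`
(`Summit.NavierStokesRegularity.NavierStokesRegularity.Theses.SqueezeCycle.ExtremalBiaxialitySubcritical`),
registered stub `stub_leakyQuarterLawCeiling` of line `quarter-bootstrap-pinning`.

**The leaky quarter law.**  For every threshold `b < 1/4`: an element `u` of the route class `𝒦_C`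
(inline: joint smoothness on the open past, `div u = 0`, the KNSS-mild Oseen identity, the Type-I rate
`HasTypeITimeDecay C u`, the scaled local energies) whose strain `S = ½(∇u + ∇uᵀ)` obeys the PRODUCTION
CEILING `−4 det S(t,x) ≤ (2b/(−t)) |S(t,x)|²_F` at every `t < 0`, `x`, vanishes identically on the past.

Proof (the sibling composition `MustSqueeze_of` of crux `MustSqueeze`, line `outward-drift-signed-flux`,
run in production currency):
* `b ↦ b⁺ = max b 0 ∈ [0, 1/4)` — the ceiling is monotone in `b` (`neg_four_det_strain_le_mono`);
* the gauge factor is absorbed in similarity variables: `∇U(s,y) = (−t)∇u(t,x)` (`fderiv_lerayOrbit`), the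
  ceiling is cubic-homogeneous, so the orbit `U = lerayOrbit u` obeys the AUTONOMOUS ceiling
  `−4 det 𝔖 ≤ 2b⁺ |𝔖|²_F` (`neg_four_det_strain_lerayOrbit_le`);
* Betchov's sign law `Ω·∇UΩ = 4 det ∇U − 4 det 𝔖` (`curlVec_dotProduct_mulVec_eq_det`) and
  `|𝔖|²_F = ½‖∇U‖²_F + ½tr(∇U∘∇U)`, `‖Ω‖² = ‖∇U‖²_F − tr(∇U∘∇U)` turn the ceiling into the pointwise production
  bound `⟪∇U Ω, Ω⟫ ≤ 4 det ∇U + b⁺ (2‖∇U‖²_F − ‖Ω‖²)` (`leakyQuarterLawCeiling_production_le`);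
* this is exactly the hypothesis of the production-currency lever `stub_signedBudgetProduction`
  (`Z_R' ≤ −2(¼ − b⁺) Z_R + K_R`); with the landed sibling stubs `stub_simDictionary`, `stub_gradEnergyBasic`,
  `stub_gradEnergyAverage`, `stub_divCurlBalls`, the abstract two-pass backward Grönwall lemma
  `stub_twoPassGronwall` at rate `c = 2(¼ − b⁺) > 0` kills every ball gradient energy of the orbit, and
  `stub_endgame` returns `u ≡ 0`.
-/

noncomputable section

open MeasureTheory Set Filter Topology
open scoped RealInnerProductSpace Matrix

set_option linter.dupNamespace false

namespace Summit.NavierStokesRegularity.NavierStokesRegularity.Theorems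

open Literature.Analysis.FluidPDE

/-! ### Matrix algebra: Betchov + production ceiling -/

-- adapted from Theorems/SqueezeCycleMustSqueezeAlgebra.lean (`curlVec_dotProduct_mulVec_le`)
/-- **Production bound from a production ceiling** (matrix form): for every real `3 × 3` matrix
`M` with `S = ½(M + Mᵀ)` and vorticity vector `ω = (M₂₁ − M₁₂, M₀₂ − M₂₀, M₁₀ − M₀₁)`, a ceiling
`−4 det S ≤ 2b ∑ᵢⱼ Sᵢⱼ²` gives `ω·Mω ≤ 4 det M + b(∑ᵢⱼ Mᵢⱼ² + tr(M²))` — Betchov's sign law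
`ω·Mω = 4 det M − 4 det S` (`curlVec_dotProduct_mulVec_eq_det`) and
`∑ Sᵢⱼ² = ½∑ Mᵢⱼ² + ½ tr(M²)` (`sum_sq_half_add_transpose`).  No trace or sign condition is
needed. [cite: Miller2019, §1 (enstrophy identity via det S and tr S³)] -/
theorem curlVec_dotProduct_mulVec_le_of_neg_det_le (M : Matrix (Fin 3) (Fin 3) ℝ) {b : ℝ}
    (hdet : -4 * ((1 / 2 : ℝ) • (M + Mᵀ)).det ≤
      2 * b * ∑ i, ∑ j, ((1 / 2 : ℝ) • (M + Mᵀ)) i j ^ 2) :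
    (![M 2 1 - M 1 2, M 0 2 - M 2 0, M 1 0 - M 0 1] : Fin 3 → ℝ) ⬝ᵥ
        (M *ᵥ (![M 2 1 - M 1 2, M 0 2 - M 2 0, M 1 0 - M 0 1] : Fin 3 → ℝ)) ≤
      4 * M.det + b * (∑ i, ∑ j, M i j ^ 2 + (M * M).trace) := by
  rw [curlVec_dotProduct_mulVec_eq_det]
  rw [sum_sq_half_add_transpose] at hdet
  nlinarith [hdet]

/-- The symmetric part commutes with scalars: `½(cM + (cM)ᵀ) = c • ½(M + Mᵀ)`. [folklore] -/
theorem half_smul_add_transpose_smul (c : ℝ) (M : Matrix (Fin 3) (Fin 3) ℝ) :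
    (1 / 2 : ℝ) • (c • M + (c • M)ᵀ) = c • ((1 / 2 : ℝ) • (M + Mᵀ)) := by
  rw [Matrix.transpose_smul, ← smul_add, smul_comm]

/-- **The production ceiling is cubic-homogeneous**: if `−4 det S ≤ (2b/c) ∑ Sᵢⱼ²` for
`S = ½(M + Mᵀ)` and `c > 0`, then the strain `c • S` of `c • M` satisfies the ceiling with the
gauge factor absorbed, `−4 det(cS) ≤ 2b ∑ (cS)ᵢⱼ²` (`det(cS) = c³ det S`, `∑(cS)ᵢⱼ² = c²∑Sᵢⱼ²`).
[folklore] -/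
theorem neg_four_det_half_add_transpose_smul_le {M : Matrix (Fin 3) (Fin 3) ℝ} {b c : ℝ}
    (hc : 0 < c)
    (h : -4 * ((1 / 2 : ℝ) • (M + Mᵀ)).det ≤
      (2 * b / c) * ∑ i, ∑ j, ((1 / 2 : ℝ) • (M + Mᵀ)) i j ^ 2) :
    -4 * ((1 / 2 : ℝ) • (c • M + (c • M)ᵀ)).det ≤
      (2 * b) * ∑ i, ∑ j, ((1 / 2 : ℝ) • (c • M + (c • M)ᵀ)) i j ^ 2 := by
  rw [half_smul_add_transpose_smul, Matrix.det_smul, Fintype.card_fin]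
  set S : Matrix (Fin 3) (Fin 3) ℝ := (1 / 2 : ℝ) • (M + Mᵀ) with hS
  have hsum : ∑ i, ∑ j, (c • S) i j ^ 2 = c ^ 2 * ∑ i, ∑ j, S i j ^ 2 := by
    simp only [Matrix.smul_apply, smul_eq_mul, mul_pow, Finset.mul_sum]
  rw [hsum]
  have hσ : 0 ≤ ∑ i, ∑ j, S i j ^ 2 :=
    Finset.sum_nonneg fun i _ => Finset.sum_nonneg fun j _ => sq_nonneg _
  have h' : c * (-4 * S.det) ≤ (2 * b) * ∑ i, ∑ j, S i j ^ 2 := by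
    have h1 := mul_le_mul_of_nonneg_left h hc.le
    have h2 : c * ((2 * b / c) * ∑ i, ∑ j, S i j ^ 2) = (2 * b) * ∑ i, ∑ j, S i j ^ 2 := by
      field_simp
    linarith [h1, h2]
  have hc2 : 0 ≤ c ^ 2 := sq_nonneg c
  calc -4 * (c ^ 3 * S.det) = c ^ 2 * (c * (-4 * S.det)) := by ring
    _ ≤ c ^ 2 * ((2 * b) * ∑ i, ∑ j, S i j ^ 2) := mul_le_mul_of_nonneg_left h' hc2
    _ = (2 * b) * (c ^ 2 * ∑ i, ∑ j, S i j ^ 2) := by ring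

/-- **The production ceiling is monotone in the threshold**: `b ≤ b'`, `0 < c` and
`−4 det S ≤ (2b/c)∑Sᵢⱼ²` give `−4 det S ≤ (2b'/c)∑Sᵢⱼ²`. [folklore] -/
theorem neg_four_det_strain_le_mono {M : Matrix (Fin 3) (Fin 3) ℝ} {b b' c : ℝ} (hbb' : b ≤ b')
    (hc : 0 < c)
    (h : -4 * ((1 / 2 : ℝ) • (M + Mᵀ)).det ≤
      (2 * b / c) * ∑ i, ∑ j, ((1 / 2 : ℝ) • (M + Mᵀ)) i j ^ 2) :
    -4 * ((1 / 2 : ℝ) • (M + Mᵀ)).det ≤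
      (2 * b' / c) * ∑ i, ∑ j, ((1 / 2 : ℝ) • (M + Mᵀ)) i j ^ 2 := by
  have hσ : 0 ≤ ∑ i, ∑ j, ((1 / 2 : ℝ) • (M + Mᵀ)) i j ^ 2 :=
    Finset.sum_nonneg fun i _ => Finset.sum_nonneg fun j _ => sq_nonneg _
  refine h.trans (mul_le_mul_of_nonneg_right ?_ hσ)
  exact div_le_div_of_nonneg_right (by linarith) hc.le

/-! ### Operator form at a point -/

-- adapted from Theorems/SqueezeCycleMustSqueezeAlgebra.lean (`inner_fderiv_curl_le`)
/-- **Pointwise production bound for a velocity gradient from a production ceiling** (operator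
form of `curlVec_dotProduct_mulVec_le_of_neg_det_le`; the production-currency twin of
`Theorems.inner_fderiv_curl_le`): for `A = ∇v(y)` with matrix `M = stdMatrix A`,
`S = ½(M + Mᵀ)`, a ceiling `−4 det S ≤ 2b ∑ Sᵢⱼ²` gives
`⟪A ω, ω⟫ ≤ 4 det A + b(‖A‖²_F + tr(A ∘ A))`, `ω = curl v (y)`.  Neither `div v = 0` nor
`0 ≤ b` is needed. [cite: Miller2019, §1 (enstrophy identity via det S and tr S³)] -/
theorem inner_fderiv_curl_le_of_neg_det_le
    {v : EuclideanSpace ℝ (Fin 3) → EuclideanSpace ℝ (Fin 3)} {y : EuclideanSpace ℝ (Fin 3)} {b : ℝ}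
    (hdet : -4 * (((1 / 2 : ℝ) •
        (stdMatrix (fderiv ℝ v y : EuclideanSpace ℝ (Fin 3) →ₗ[ℝ] EuclideanSpace ℝ (Fin 3)) +
          (stdMatrix (fderiv ℝ v y :
            EuclideanSpace ℝ (Fin 3) →ₗ[ℝ] EuclideanSpace ℝ (Fin 3)))ᵀ))).det ≤
      (2 * b) * (∑ i, ∑ j, (((1 / 2 : ℝ) •
        (stdMatrix (fderiv ℝ v y : EuclideanSpace ℝ (Fin 3) →ₗ[ℝ] EuclideanSpace ℝ (Fin 3)) +
          (stdMatrix (fderiv ℝ v y :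
            EuclideanSpace ℝ (Fin 3) →ₗ[ℝ] EuclideanSpace ℝ (Fin 3)))ᵀ)) i j) ^ 2)) :
    ⟪fderiv ℝ v y (curl v y), curl v y⟫ ≤
      4 * LinearMap.det (fderiv ℝ v y : EuclideanSpace ℝ (Fin 3) →ₗ[ℝ] EuclideanSpace ℝ (Fin 3)) +
        b * (frobeniusNormSq (fderiv ℝ v y) +
          LinearMap.trace ℝ (EuclideanSpace ℝ (Fin 3))
            ((fderiv ℝ v y : EuclideanSpace ℝ (Fin 3) →ₗ[ℝ] EuclideanSpace ℝ (Fin 3)) ∘ₗ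
              (fderiv ℝ v y : EuclideanSpace ℝ (Fin 3) →ₗ[ℝ] EuclideanSpace ℝ (Fin 3)))) := by
  have key := curlVec_dotProduct_mulVec_le_of_neg_det_le _ hdet
  -- translate the four quantities
  have hAapp : ∀ w : Fin 3 → ℝ, fderiv ℝ v y (WithLp.toLp 2 w) =
      WithLp.toLp 2 (stdMatrix (fderiv ℝ v y :
        EuclideanSpace ℝ (Fin 3) →ₗ[ℝ] EuclideanSpace ℝ (Fin 3)) *ᵥ w) := by
    intro w
    have h := congrArg
      (fun L : EuclideanSpace ℝ (Fin 3) →ₗ[ℝ] EuclideanSpace ℝ (Fin 3) => L (WithLp.toLp 2 w))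
      (toEuclideanLin_stdMatrix (fderiv ℝ v y :
        EuclideanSpace ℝ (Fin 3) →ₗ[ℝ] EuclideanSpace ℝ (Fin 3)))
    simp only [ContinuousLinearMap.coe_coe] at h
    rw [← h]
    exact Matrix.toLpLin_apply 2 2 _ _
  have hinner : ∀ w : Fin 3 → ℝ, ⟪fderiv ℝ v y (WithLp.toLp 2 w), WithLp.toLp 2 w⟫ =
      w ⬝ᵥ (stdMatrix (fderiv ℝ v y :
        EuclideanSpace ℝ (Fin 3) →ₗ[ℝ] EuclideanSpace ℝ (Fin 3)) *ᵥ w) := by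
    intro w
    rw [hAapp, EuclideanSpace.inner_eq_star_dotProduct, WithLp.ofLp_toLp, WithLp.ofLp_toLp,
      star_trivial, dotProduct_comm]
  have hdet' : LinearMap.det (fderiv ℝ v y :
      EuclideanSpace ℝ (Fin 3) →ₗ[ℝ] EuclideanSpace ℝ (Fin 3)) =
      (stdMatrix (fderiv ℝ v y : EuclideanSpace ℝ (Fin 3) →ₗ[ℝ] EuclideanSpace ℝ (Fin 3))).det :=
    (LinearMap.det_toMatrix (EuclideanSpace.basisFun (Fin 3) ℝ).toBasis
      (fderiv ℝ v y : EuclideanSpace ℝ (Fin 3) →ₗ[ℝ] EuclideanSpace ℝ (Fin 3))).symm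
  have hfrob := frobeniusNormSq_eq_sum_sq_stdMatrix (fderiv ℝ v y)
  have htr2 : LinearMap.trace ℝ (EuclideanSpace ℝ (Fin 3))
      ((fderiv ℝ v y : EuclideanSpace ℝ (Fin 3) →ₗ[ℝ] EuclideanSpace ℝ (Fin 3)) ∘ₗ
        (fderiv ℝ v y : EuclideanSpace ℝ (Fin 3) →ₗ[ℝ] EuclideanSpace ℝ (Fin 3))) =
      (stdMatrix (fderiv ℝ v y : EuclideanSpace ℝ (Fin 3) →ₗ[ℝ] EuclideanSpace ℝ (Fin 3)) *
        stdMatrix (fderiv ℝ v y : EuclideanSpace ℝ (Fin 3) →ₗ[ℝ] EuclideanSpace ℝ (Fin 3))).trace := by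
    rw [← trace_stdMatrix, stdMatrix_comp]
  rw [curl_eq_stdMatrix v y, hinner, hdet', hfrob, htr2]
  exact key

/-! ### Absorbing the gauge factor in similarity variables -/

/-- **The velocity-gradient matrix of the orbit**: `stdMatrix ∇U(s,y) = e^{−s} • stdMatrix ∇u(t,x)`
at `(t, x) = (−e^{−s}, e^{−s/2}y)`, `U = lerayOrbit u` (`fderiv_lerayOrbit`, linearity of
`stdMatrix`). [folklore] -/
theorem stdMatrix_fderiv_lerayOrbit (u : ℝ → EuclideanSpace ℝ (Fin 3) → EuclideanSpace ℝ (Fin 3))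
    (s : ℝ) (y : EuclideanSpace ℝ (Fin 3)) :
    stdMatrix (fderiv ℝ (lerayOrbit u s) y : EuclideanSpace ℝ (Fin 3) →ₗ[ℝ] EuclideanSpace ℝ (Fin 3)) =
      Real.exp (-s) • stdMatrix (fderiv ℝ (u (-Real.exp (-s))) (Real.exp (-s / 2) • y) :
        EuclideanSpace ℝ (Fin 3) →ₗ[ℝ] EuclideanSpace ℝ (Fin 3)) := by
  rw [fderiv_lerayOrbit, ContinuousLinearMap.toLinearMap_smul]
  exact LinearEquiv.map_smul _ _ _

/-- **The production ceiling in similarity variables**: if `u` satisfies the physical ceiling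
`−4 det S(t,x) ≤ (2b/(−t)) ∑ S(t,x)ᵢⱼ²` at every `t < 0`, `x` (`S = ½(M + Mᵀ)`,
`M = stdMatrix ∇u(t,x)`), then the orbit `U = lerayOrbit u` satisfies the autonomous ceiling
`−4 det 𝔖(s,y) ≤ 2b ∑ 𝔖(s,y)ᵢⱼ²` at every `s`, `y` (`𝔖 = ½(M_U + M_Uᵀ)`, `M_U = stdMatrix ∇U(s,y)
= (−t) M`): the ceiling is cubic-homogeneous and `(−t)³ · (2b/(−t)) = 2b (−t)²`. [folklore] -/
theorem neg_four_det_strain_lerayOrbit_le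
    {u : ℝ → EuclideanSpace ℝ (Fin 3) → EuclideanSpace ℝ (Fin 3)} {b : ℝ}
    (hceil : ∀ t < 0, ∀ x, -4 * (((1 / 2 : ℝ) • (Literature.Analysis.FluidPDE.stdMatrix (fderiv ℝ (u t) x : EuclideanSpace ℝ (Fin 3) →ₗ[ℝ] EuclideanSpace ℝ (Fin 3)) + (Literature.Analysis.FluidPDE.stdMatrix (fderiv ℝ (u t) x : EuclideanSpace ℝ (Fin 3) →ₗ[ℝ] EuclideanSpace ℝ (Fin 3)))ᵀ))).det ≤ (2 * b / (-t)) * (∑ i, ∑ j, (((1 / 2 : ℝ) • (Literature.Analysis.FluidPDE.stdMatrix (fderiv ℝ (u t) x : EuclideanSpace ℝ (Fin 3) →ₗ[ℝ] EuclideanSpace ℝ (Fin 3)) + (Literature.Analysis.FluidPDE.stdMatrix (fderiv ℝ (u t) x : EuclideanSpace ℝ (Fin 3) →ₗ[ℝ] EuclideanSpace ℝ (Fin 3)))ᵀ)) i j) ^ 2))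
    (s : ℝ) (y : EuclideanSpace ℝ (Fin 3)) :
    -4 * (((1 / 2 : ℝ) •
        (stdMatrix (fderiv ℝ (lerayOrbit u s) y : EuclideanSpace ℝ (Fin 3) →ₗ[ℝ] EuclideanSpace ℝ (Fin 3)) +
          (stdMatrix (fderiv ℝ (lerayOrbit u s) y :
            EuclideanSpace ℝ (Fin 3) →ₗ[ℝ] EuclideanSpace ℝ (Fin 3)))ᵀ))).det ≤
      (2 * b) * (∑ i, ∑ j, (((1 / 2 : ℝ) •
        (stdMatrix (fderiv ℝ (lerayOrbit u s) y : EuclideanSpace ℝ (Fin 3) →ₗ[ℝ] EuclideanSpace ℝ (Fin 3)) +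
          (stdMatrix (fderiv ℝ (lerayOrbit u s) y :
            EuclideanSpace ℝ (Fin 3) →ₗ[ℝ] EuclideanSpace ℝ (Fin 3)))ᵀ)) i j) ^ 2) := by
  have ht : -Real.exp (-s) < 0 := neg_neg_of_pos (Real.exp_pos _)
  have key := hceil _ ht (Real.exp (-s / 2) • y)
  rw [neg_neg] at key
  rw [stdMatrix_fderiv_lerayOrbit]
  exact neg_four_det_half_add_transpose_smul_le (Real.exp_pos _) key

/-- **The production step of the leaky quarter law in production-ceiling currency**: under the
physical ceiling `−4 det S(t,x) ≤ (2b/(−t)) ∑ S(t,x)ᵢⱼ²` (all `t < 0`, `x`), the orbit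
`U = lerayOrbit u` and its vorticity `Ω = lerayVorticity u = curl U` satisfy, at every `s`, `y`,
`⟪∇U Ω, Ω⟫ ≤ 4 det ∇U + b⁺ (2‖∇U‖²_F − ‖Ω‖²)`, `b⁺ = max b 0` — the ceiling at `b` is one at `b⁺`
(`neg_four_det_strain_le_mono`), Betchov's `Ω·∇UΩ = 4 det ∇U − 4 det 𝔖`, the autonomous ceiling
`−4 det 𝔖 ≤ 2b⁺|𝔖|²_F = b⁺(‖∇U‖²_F + tr ∇U²)` (`inner_fderiv_curl_le_of_neg_det_le`,
`neg_four_det_strain_lerayOrbit_le`) and `‖Ω‖² = ‖∇U‖²_F − tr(∇U∘∇U)`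
(`norm_curl_sq_eq_frobeniusNormSq_sub_trace`).  This is verbatim the hypothesis `hprod` of the
production-currency lever `stub_signedBudgetProduction` at threshold `b⁺`.
[cite: Miller2019, §1 (enstrophy identity via det S and tr S³)] -/
theorem leakyQuarterLawCeiling_production_le
    {u : ℝ → EuclideanSpace ℝ (Fin 3) → EuclideanSpace ℝ (Fin 3)} {b : ℝ}
    (hceil : ∀ t < 0, ∀ x, -4 * (((1 / 2 : ℝ) • (Literature.Analysis.FluidPDE.stdMatrix (fderiv ℝ (u t) x : EuclideanSpace ℝ (Fin 3) →ₗ[ℝ] EuclideanSpace ℝ (Fin 3)) + (Literature.Analysis.FluidPDE.stdMatrix (fderiv ℝ (u t) x : EuclideanSpace ℝ (Fin 3) →ₗ[ℝ] EuclideanSpace ℝ (Fin 3)))ᵀ))).det ≤ (2 * b / (-t)) * (∑ i, ∑ j, (((1 / 2 : ℝ) • (Literature.Analysis.FluidPDE.stdMatrix (fderiv ℝ (u t) x : EuclideanSpace ℝ (Fin 3) →ₗ[ℝ] EuclideanSpace ℝ (Fin 3)) + (Literature.Analysis.FluidPDE.stdMatrix (fderiv ℝ (u t) x : EuclideanSpace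 ℝ (Fin 3) →ₗ[ℝ] EuclideanSpace ℝ (Fin 3)))ᵀ)) i j) ^ 2))
    (s : ℝ) (y : EuclideanSpace ℝ (Fin 3)) :
    ⟪fderiv ℝ (lerayOrbit u s) y (lerayVorticity u s y), lerayVorticity u s y⟫ ≤
      4 * LinearMap.det (fderiv ℝ (lerayOrbit u s) y :
          EuclideanSpace ℝ (Fin 3) →ₗ[ℝ] EuclideanSpace ℝ (Fin 3)) +
        max b 0 * (2 * frobeniusNormSq (fderiv ℝ (lerayOrbit u s) y) - ‖lerayVorticity u s y‖ ^ 2) := by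
  -- the ceiling at `b` is a ceiling at `b⁺ = max b 0`
  have hceil' : ∀ t < 0, ∀ x, -4 * (((1 / 2 : ℝ) •
      (stdMatrix (fderiv ℝ (u t) x : EuclideanSpace ℝ (Fin 3) →ₗ[ℝ] EuclideanSpace ℝ (Fin 3)) +
        (stdMatrix (fderiv ℝ (u t) x : EuclideanSpace ℝ (Fin 3) →ₗ[ℝ] EuclideanSpace ℝ (Fin 3)))ᵀ))).det ≤
      (2 * max b 0 / (-t)) * (∑ i, ∑ j, (((1 / 2 : ℝ) •
        (stdMatrix (fderiv ℝ (u t) x : EuclideanSpace ℝ (Fin 3) →ₗ[ℝ] EuclideanSpace ℝ (Fin 3)) +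
          (stdMatrix (fderiv ℝ (u t) x : EuclideanSpace ℝ (Fin 3) →ₗ[ℝ] EuclideanSpace ℝ (Fin 3)))ᵀ)) i j) ^ 2) :=
    fun t ht x => neg_four_det_strain_le_mono (le_max_left b 0) (neg_pos.2 ht) (hceil t ht x)
  -- Betchov + the autonomous ceiling on the orbit
  have key := inner_fderiv_curl_le_of_neg_det_le (neg_four_det_strain_lerayOrbit_le hceil' s y)
  -- `‖Ω‖² = ‖∇U‖²_F − tr(∇U∘∇U)`
  have hcurl := norm_curl_sq_eq_frobeniusNormSq_sub_trace (lerayOrbit u s) y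
  rw [lerayVorticity_apply]
  have e : frobeniusNormSq (fderiv ℝ (lerayOrbit u s) y) +
      LinearMap.trace ℝ (EuclideanSpace ℝ (Fin 3))
        ((fderiv ℝ (lerayOrbit u s) y : EuclideanSpace ℝ (Fin 3) →ₗ[ℝ] EuclideanSpace ℝ (Fin 3)) ∘ₗ
          (fderiv ℝ (lerayOrbit u s) y : EuclideanSpace ℝ (Fin 3) →ₗ[ℝ] EuclideanSpace ℝ (Fin 3))) =
      2 * frobeniusNormSq (fderiv ℝ (lerayOrbit u s) y) - ‖curl (lerayOrbit u s) y‖ ^ 2 := by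
    linarith
  rw [← e]
  exact key

/-! ### The stub -/

-- adapted from Theorems/SqueezeCycleExtremalBiaxialitySubcriticalMustSqueezeFamily.lean (`mustSqueeze_family` = `MustSqueeze_of` at a general threshold)
/-- **`stub_leakyQuarterLawCeiling`** (line `quarter-bootstrap-pinning`, registered stub; the leaky quarter
law in production-ceiling currency): for every `b < 1/4`, an element of the route class `𝒦_C` whose strain
obeys `−4 det S(t,x) ≤ (2b/(−t)) |S(t,x)|²_F` at every `t < 0`, `x` vanishes identically on the past.
Proof: the inline class is the tree's `IsTypeIAncientMild C u` (`isTypeIAncientMild_of_squeezeClass`);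
the ceiling gives the pointwise production bound on the similarity orbit at threshold `b⁺ = max b 0 < 1/4`
(`leakyQuarterLawCeiling_production_le`), which feeds the production-currency lever
`stub_signedBudgetProduction`; the sibling crux's landed stubs `stub_simDictionary`, `stub_gradEnergyBasic`,
`stub_gradEnergyAverage`, `stub_divCurlBalls` supply the remaining inputs of the abstract two-pass backward
Grönwall lemma `stub_twoPassGronwall` (rate `c = 2(¼ − b⁺) > 0`), which kills every ball gradient energy
of the orbit, and `stub_endgame` returns `u ≡ 0`. [folklore] -/
theorem stub_leakyQuarterLawCeiling : ∀ (C b : ℝ), b < 1 / 4 → ∀ (u : ℝ → EuclideanSpace ℝ (Fin 3) → EuclideanSpace ℝ (Fin 3)), ContDiffOn ℝ (⊤ : ℕ∞) (Function.uncurry u) (Set.Iio 0 ×ˢ Set.univ) ∧ (∀ t < 0, Literature.Analysis.FluidPDE.VectorCalculus.IsDivFree (u t)) ∧ (∀ s t : ℝ, s < t → t < 0 → ∀ x, u t x = Literature.Analysis.FluidPDE.heatFlow (u s) (t-s) x - ∫ τ in Set.Ioo s t, ∫ y, ((-(inner ℝ (x-y) (u τ y) / (2*(t-τ)) * Literature.Analysis.UnboundedOperators.heatKernel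 (t-τ) (x-y))) • u τ y + (∫ σ in Set.Ioi (t-τ), Literature.Analysis.UnboundedOperators.heatKernel σ (x-y) / (4*σ^2)) • (inner ℝ (x-y) (u τ y) • u τ y + inner ℝ (u τ y) (u τ y) • (x-y) + inner ℝ (x-y) (u τ y) • u τ y) - ((∫ σ in Set.Ioi (t-τ), Literature.Analysis.UnboundedOperators.heatKernel σ (x-y) / (8*σ^3)) * (inner ℝ (x-y) (u τ y) * inner ℝ (x-y) (u τ y))) • (x-y))) ∧ Literature.Analysis.FluidPDE.HasTypeITimeDecay C u ∧ (∀ (x₀ : EuclideanSpace ℝ (Fin 3)) (t₀ r : ℝ), t₀ ≤ 0 → 0 < r → (∀ t, t₀ - r^2 < t → t < t₀ → r⁻¹ * ∫ x in Metric.ball x₀ r, ‖u t x‖^2 ≤ C) ∧ r⁻¹ * ∫ t in Set.Ioo (t₀ - r^2) t₀, ∫ x in Metric.ball x₀ r, ‖fderiv ℝ (u t) x‖^2 ≤ C) → (∀ t < 0, ∀ x, -4 * (((1 / 2 : ℝ) • (Literature.Analysis.FluidPDE.stdMatrix (fderiv ℝ (u t) x : EuclideanSpace ℝ (Fin 3)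 →ₗ[ℝ] EuclideanSpace ℝ (Fin 3)) + (Literature.Analysis.FluidPDE.stdMatrix (fderiv ℝ (u t) x : EuclideanSpace ℝ (Fin 3) →ₗ[ℝ] EuclideanSpace ℝ (Fin 3)))ᵀ))).det ≤ (2 * b / (-t)) * (∑ i, ∑ j, (((1 / 2 : ℝ) • (Literature.Analysis.FluidPDE.stdMatrix (fderiv ℝ (u t) x : EuclideanSpace ℝ (Fin 3) →ₗ[ℝ] EuclideanSpace ℝ (Fin 3)) + (Literature.Analysis.FluidPDE.stdMatrix (fderiv ℝ (u t) x : EuclideanSpace ℝ (Fin 3) →ₗ[ℝ] EuclideanSpace ℝ (Fin 3)))ᵀ)) i j) ^ 2)) → ∀ t < 0, ∀ x, u t x = 0 := by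
  intro C b hb u hu hceil
  obtain ⟨h1, h2, h3, h4, h5⟩ := hu
  -- the inline class is the tree's Type-I KNSS-mild class
  have hK : IsTypeIAncientMild C u := isTypeIAncientMild_of_squeezeClass h1 h2 h3 h4
  -- the nonnegative threshold `b⁺ = max b 0`, still `< 1/4`
  have hb0 : (0 : ℝ) ≤ max b 0 := le_max_right b 0
  have hb4 : max b 0 < 1 / 4 := max_lt hb (by norm_num)
  -- the production ceiling ⇒ the pointwise production bound on the orbit at threshold `b⁺`
  have hprod : ∀ (s : ℝ) (y : EuclideanSpace ℝ (Fin 3)),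
      ⟪fderiv ℝ (lerayOrbit u s) y (lerayVorticity u s y), lerayVorticity u s y⟫ ≤
        4 * LinearMap.det (fderiv ℝ (lerayOrbit u s) y :
            EuclideanSpace ℝ (Fin 3) →ₗ[ℝ] EuclideanSpace ℝ (Fin 3)) +
          max b 0 * (2 * frobeniusNormSq (fderiv ℝ (lerayOrbit u s) y) - ‖lerayVorticity u s y‖ ^ 2) :=
    leakyQuarterLawCeiling_production_le hceil
  -- the landed stubs of line outward-drift-signed-flux (crux MustSqueeze) and the production lever
  obtain ⟨hUle, hMorrey⟩ := stub_simDictionary C u hK h5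
  obtain ⟨hE0, hEcont, hEmono⟩ := stub_gradEnergyBasic C u hK
  have hEavg := stub_gradEnergyAverage C u hK h5 hEcont
  obtain ⟨κ', hdc⟩ := stub_divCurlBalls C u hK hMorrey
  obtain ⟨κ, hbudget⟩ := stub_signedBudgetProduction C (max b 0) κ' u hK hprod hb0 hUle hEcont
    (fun R s hR => (hdc R s hR).2.1)
  -- abstract two-pass Grönwall
  set Z : ℝ → ℝ → ℝ := fun R s =>
    ∫ y, Real.smoothTransition (2 - ‖y‖ ^ 2 / R ^ 2) * ‖lerayVorticity u s y‖ ^ 2 with hZ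
  set E : ℝ → ℝ → ℝ := fun ρ s =>
    ∫ y in Metric.ball (0 : EuclideanSpace ℝ (Fin 3)) ρ,
      frobeniusNormSq (fderiv ℝ (lerayOrbit u s) y) with hE
  have hc : (0 : ℝ) < 2 * (1 / 4 - max b 0) := by linarith
  have hZ0 : ∀ R s : ℝ, 1 ≤ R → 0 ≤ Z R s := fun R s _ =>
    integral_nonneg fun y => mul_nonneg (Real.smoothTransition.nonneg _) (sq_nonneg _)
  have hbudget' : ∀ R : ℝ, 1 ≤ R → Differentiable ℝ (Z R) ∧ ∃ K : ℝ → ℝ, Continuous K ∧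
      (∀ s, 0 ≤ K s) ∧ (∀ s, K s ≤ κ * (E (2 * R) s / R + Real.sqrt (E (2 * R) s / R))) ∧
      ∀ s, deriv (Z R) s ≤ -(2 * (1 / 4 - max b 0)) * Z R s + K s := fun R hR => hbudget R hR
  have hvan : ∀ ρ s : ℝ, 0 < ρ → E ρ s = 0 :=
    stub_twoPassGronwall (2 * (1 / 4 - max b 0)) κ κ' (6 * C) Z E hc hE0 hEcont hEmono hEavg
      hbudget' hZ0 (fun R R' s hR hRR' => (hdc R s hR).2.2.2 R' hRR') (fun R s hR => (hdc R s hR).1)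
      (fun R s hR => ((hdc R s hR).2.2.1).trans ((hdc R s hR).2.1))
  exact stub_endgame C u hK hMorrey hvan

end Summit.NavierStokesRegularity.NavierStokesRegularity.Theorems

end
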